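import Literature.Probability.LatticeModels.TemperleyLiebLinkModule
import HarnessLib

/-!
# The planar Temperley–Lieb module at loop weight `1` is generated by any vector of non-zero total mass: the odd-staircase collapse and the transitivity of the Jones monoid on link patterns («TL-PERCOLATION-HEAD»)

Topic `Literature/Probability/LatticeModels`; a rider on `TemperleyLiebLinkModule.lean` (Pearce–Rittenberg–de Gier–Nienhuis 2002: the planar module `LinkPattern (n+2) →₀ R`
with generators `tlL δ j`, `tlL_single`, the move `LinkPattern.connectSucc` — planar by the marked-loop bridge) and `TemperleyLiebLinkRelations.lean` (bookkeeping of
`connect`). Ridout–Saint-Aubin (2014, Prop. 3.3, proved with the «magic» identity `|x y| z = ⟨y, z⟩ x`): if the invariant bilinear form of a standard module is not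
identically zero, the module is CYCLIC, generated by every vector outside the radical, and the radical is its unique maximal proper submodule. At the percolation point
`δ = 1` with zero defects every pairing of two link states closes loops of weight `1`, so `⟨x, y⟩ = ε(x) ε(y)` with `ε` the TOTAL MASS, and the radical is the hyperplane
`ker ε`. This file proves that statement ELEMENTARILY in the lineage's coordinates, for `2m + 2` sites (generators `e_0, …, e_{2m}`):

PART 1 — THE COLLAPSE.
* `LinkPattern.base m` — the BASE link pattern `{0,1}{2,3}⋯{2m, 2m+1}`, `LinkPattern.eq_base_of_even`; `totalMass` (`ε`), ★ `totalMass_tlL_one` — at `δ = 1` every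
  generator preserves the total mass (`ε ∘ e_j = ε`: Pearce–Rittenberg–de Gier–Nienhuis's `H = Σ (1 − e_j)` is an intensity matrix), so `ker ε` is a stable hyperplane;
* `staircase m P t` — the pattern after the moves at the even sites `0, 2, …, 2(t−1)`; ★★ `staircase_full` — **THE ODD-STAIRCASE WORD `e_{2m} ⋯ e_2 e_0` COLLAPSES EVERY
  LINK PATTERN ONTO THE BASE PATTERN** (the word is the diagram `|base base|`); `collapse m` — the endomorphism `tlL 1 (2m) ∘ ⋯ ∘ tlL 1 0`, ★★ `collapse_single`
  (`collapse (δ_P) = δ_base`), `collapse_apply` (`collapse x = ε(x) · δ_base`);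
* ★★ `single_base_mem_of_stable` — a subspace (over a field) stable under every `e_j` at `δ = 1` and containing a vector of non-zero total mass contains `δ_base`.

PART 2 — TRANSITIVITY AND THE HEAD.
* `LinkPattern.applyMoves` — a word of moves applied to a link pattern; `PerfectMatching.area` — the total chord width `Σ_i |p(i) − i|`;
* ★ `LinkPattern.eq_base_of_forall_adjacent` — a link pattern all of whose chords are nearest-neighbour chords is the base pattern; `exists_wide_chord`; ★
  `exists_minimal_chord` — a non-adjacent chord `{a, c}` of MINIMAL width encloses the nearest-neighbour chord `{a+1, a+2}` (planarity + minimality);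
* ★★ `connectSucc_connectSucc_eq` — **the raising identity** `(Q · e_a) · e_{a+1} = Q` for such a chord (`Q · e_a` has the chords `{a, a+1}, {a+2, c}` and is a link
  pattern by the tree's `isNonCrossing_connect_succ`), `area_connectSucc_add_four` / `area_connectSucc_lt` (it lowers the area by `4`);
* ★★★ `LinkPattern.exists_moves_eq` — **THE JONES (TEMPERLEY–LIEB) MONOID ACTS TRANSITIVELY ON THE LINK PATTERNS OF `2m+2` SITES**: every link pattern is reached from
  the base pattern by a word of nearest-neighbour moves (strong induction on the area);
* ★★★ `eq_top_of_stable` — **AT `δ = 1`, A SUBSPACE OF THE PLANAR MODULE (over a field) STABLE UNDER EVERY GENERATOR AND CONTAINING A VECTOR OF NON-ZERO TOTAL MASS IS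
  THE WHOLE MODULE**; ★★ `le_ker_totalMass_of_stable_of_ne_top` — every proper stable subspace lies in `ker ε`: the radical is the unique maximal submodule
  (Ridout–Saint-Aubin's Prop. 3.3 at `β = 1`, zero defects); ★★ `span_eq_top_of_stable` — the span of a family stable under the generators and containing one vector of
  non-zero mass is everything.

Why the lane wants it (tree `Percolation/MarkedLoopBoundaryLawModule.lean`, HOME `FINDING-TRIPOD-DOOR-U-TWO-CORNER.md`): boundary non-degeneracy of Khristoforov–Smirnov's
multi-disorder observables ⟺ the percolation boundary link-pattern laws span the planar module; laws have POSITIVE total mass, so by `span_eq_top_of_stable` it suffices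
that their span be stable under the generators — a local (plaquette-type) closure property of the family of boundary laws replaces a rank computation.

## References
* D. Ridout, Y. Saint-Aubin, *Standard modules, induction and the structure of the Temperley–Lieb algebra*, Adv. Theor. Math. Phys. 18 (2014) 957–1041 = arXiv:1204.4505,
  §3 Prop. 3.3 and its proof (arXiv p. 13: «`|x y| z = ⟨y, z⟩ x` … thus `z` generates»; «the radical is the unique maximal proper submodule»).
* P. A. Pearce, V. Rittenberg, J. de Gier, B. Nienhuis, *Temperley–Lieb stochastic processes*, J. Phys. A 35 (2002) L661–L668, §2 ((TL), (monoid): the moves on link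
  patterns; `H = Σ_j (1 − e_j)` as a stochastic process at `q = e^{iπ/3}`).

## Mathlib / tree
Tree: `TemperleyLiebLinkModule.lean` (`tlL`, `tlL_single`, `LinkPattern.connectSucc`, `connectSucc_val`, `connectSucc_of_partner_eq`), `TemperleyLiebLinkPatterns.lean`
(`PerfectMatching`, `connect_partner`, `connect_partner_left/right`, `partner_partner`, `partner_ne`, `partner_inj`, `PerfectMatching.ext`, `IsNonCrossing`, `LinkPattern`),
`TemperleyLiebLinkRelations.lean` (`connect_partner_partner_left/right`, `connect_partner_of_ne`). Mathlib: `Finsupp.linearCombination`, `Finsupp.induction_linear`,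
`Finsupp.smul_single_one`, `Finset.exists_min_image`, `Finset.sum_add_sum_compl`, `Finset.sum_insert`, `Nat.strong_induction_on`, `List.foldl`, `List.reverseRecOn`.
-/

namespace Literature.Probability.LatticeModels.TemperleyLieb

open Function Finset

/-! ## Part 1 — the base pattern, the total mass, the odd-staircase collapse -/

/-! ### The base pattern -/

section Base

variable (m : ℕ)

/-- the partner function of the base pattern: `2i ↦ 2i+1`, `2i+1 ↦ 2i`. [cite: PearceRittenbergDeGierNienhuis2002, §2 (link patterns)] -/
def basePartner (i : Fin (2 * m + 1 + 1)) : Fin (2 * m + 1 + 1) :=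
  if h : i.val % 2 = 0 then ⟨i.val + 1, by have := i.2; omega⟩ else ⟨i.val - 1, by have := i.2; omega⟩

/-- its value. [cite: PearceRittenbergDeGierNienhuis2002, §2] -/
theorem basePartner_val (i : Fin (2 * m + 1 + 1)) : (basePartner m i).val = if i.val % 2 = 0 then i.val + 1 else i.val - 1 := by
  unfold basePartner
  split_ifs <;> rfl

/-- **the BASE pairing** `{0,1}{2,3}⋯{2m,2m+1}` of `2m+2` sites. [cite: PearceRittenbergDeGierNienhuis2002, §2 (link patterns)] -/
def PerfectMatching.base : PerfectMatching (2 * m + 1 + 1) where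
  partner := basePartner m
  partner_partner i := by
    apply Fin.ext
    rw [basePartner_val, basePartner_val]
    have := i.2
    split_ifs <;> omega
  partner_ne i h := by
    have e := congrArg Fin.val h
    rw [basePartner_val] at e
    split_ifs at e <;> omega

/-- the base pairing is non-crossing. [cite: PearceRittenbergDeGierNienhuis2002, §2 (non-intersecting half-loops)] -/
theorem isNonCrossing_base : IsNonCrossing (PerfectMatching.base m) := by
  intro a b hab h1 h2
  exfalso
  have e1 : ((PerfectMatching.base m).partner a).val = if a.val % 2 = 0 then a.val + 1 else a.val - 1 := basePartner_val m a
  rw [Fin.lt_def] at hab h1 h2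
  split_ifs at e1 <;> omega

/-- ★ **the BASE link pattern** `{0,1}{2,3}⋯{2m,2m+1}`. [cite: PearceRittenbergDeGierNienhuis2002, §2 (link patterns)] -/
def LinkPattern.base : LinkPattern (2 * m + 1 + 1) := ⟨PerfectMatching.base m, isNonCrossing_base m⟩

/-- its partner function. [cite: PearceRittenbergDeGierNienhuis2002, §2] -/
theorem LinkPattern.base_partner_val (i : Fin (2 * m + 1 + 1)) :
    ((LinkPattern.base m).1.partner i).val = if i.val % 2 = 0 then i.val + 1 else i.val - 1 := basePartner_val m i

/-- a link pattern pairing every even site with its successor IS the base pattern. [cite: PearceRittenbergDeGierNienhuis2002, §2 (link patterns)] -/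
theorem LinkPattern.eq_base_of_even (P : LinkPattern (2 * m + 1 + 1))
    (h : ∀ i : Fin (2 * m + 1 + 1), i.val % 2 = 0 → (P.1.partner i).val = i.val + 1) : P = LinkPattern.base m := by
  apply Subtype.ext
  apply PerfectMatching.ext
  funext i
  apply Fin.ext
  rw [LinkPattern.base_partner_val]
  by_cases hi : i.val % 2 = 0
  · rw [if_pos hi, h i hi]
  · rw [if_neg hi]
    -- `i` is odd: its predecessor `i−1` is even and pairs with `i`, so `i` pairs with `i−1`
    have hi1 : 1 ≤ i.val := by omega
    let i' : Fin (2 * m + 1 + 1) := ⟨i.val - 1, by have := i.2; omega⟩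
    have hi' : i'.val % 2 = 0 := by show (i.val - 1) % 2 = 0; omega
    have hp : (P.1.partner i').val = i'.val + 1 := h i' hi'
    have hpi : P.1.partner i' = i := Fin.ext (by rw [hp]; show i.val - 1 + 1 = i.val; omega)
    have : P.1.partner i = i' := by rw [← hpi, P.1.partner_partner]
    rw [this]

end Base

/-! ### Total mass and its invariance at `δ = 1` -/

section Mass

variable (R : Type*) [CommRing R] {n : ℕ}

/-- **the TOTAL MASS** `ε(x) = Σ_P x(P)` of a vector of the planar module (the pairing `⟨x, y⟩ = ε(x) ε(y)` of two zero-defect link states at loop weight `1`).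
[cite: RidoutSaintAubin2014TL, §3 (the invariant bilinear form; arXiv p. 13)] -/
noncomputable def totalMass : (LinkPattern (n + 1 + 1) →₀ R) →ₗ[R] R := Finsupp.linearCombination R fun _ => (1 : R)

variable {R}

/-- the total mass of a basis vector. [cite: RidoutSaintAubin2014TL, §3 (arXiv p. 13)] -/
theorem totalMass_single (P : LinkPattern (n + 1 + 1)) (c : R) : totalMass R (Finsupp.single P c) = c := by
  rw [totalMass, Finsupp.linearCombination_single, smul_eq_mul, mul_one]

/-- at `δ = 1` a generator maps a basis vector to a basis vector. [cite: PearceRittenbergDeGierNienhuis2002, §2 (monoid): loops are erased at weight `q + q⁻¹ = 1`] -/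
theorem tlL_one_single (j : Fin (n + 1)) (P : LinkPattern (n + 1 + 1)) (c : R) :
    tlL R 1 j (Finsupp.single P c) = Finsupp.single (P.connectSucc j) c := by
  rw [tlL_single]
  split_ifs <;> rw [one_smul]

/-- ★ **AT `δ = 1` EVERY GENERATOR PRESERVES THE TOTAL MASS** (`ε ∘ e_j = ε`; the hyperplane `ker ε` is stable — it is the radical of Ridout–Saint-Aubin).
[cite: PearceRittenbergDeGierNienhuis2002, §2 (`H = Σ_j (1 − e_j)` as a stochastic process); RidoutSaintAubin2014TL, §3 Prop. 3.3 (arXiv p. 13)] -/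
theorem totalMass_tlL_one (j : Fin (n + 1)) (x : LinkPattern (n + 1 + 1) →₀ R) : totalMass R (tlL R 1 j x) = totalMass R x := by
  induction x using Finsupp.induction_linear with
  | zero => rw [map_zero]
  | add x y hx hy => rw [map_add, map_add, hx, hy, map_add]
  | single P c => rw [tlL_one_single, totalMass_single, totalMass_single]

end Mass

/-! ### The odd staircase -/

section Staircase

variable (m : ℕ)

/-- the even site `2t` as a generator index (`t ≤ m`). [cite: PearceRittenbergDeGierNienhuis2002, §2] -/
def evenGen (t : Fin (m + 1)) : Fin (2 * m + 1) := ⟨2 * t.val, by have := t.2; omega⟩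

/-- **the staircase**: apply the moves at the even sites `0, 2, …, 2(t−1)` in turn. [cite: RidoutSaintAubin2014TL, §3 proof of Prop. 3.3 (the diagram `|x y|`, arXiv p. 13)] -/
noncomputable def staircase (P : LinkPattern (2 * m + 1 + 1)) : ℕ → LinkPattern (2 * m + 1 + 1)
  | 0 => P
  | t + 1 => if h : t < m + 1 then (staircase P t).connectSucc (evenGen m ⟨t, h⟩) else staircase P t

/-- the recursion step inside the range. [cite: RidoutSaintAubin2014TL, §3 (arXiv p. 13)] -/
theorem staircase_succ (P : LinkPattern (2 * m + 1 + 1)) {t : ℕ} (h : t < m + 1) :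
    staircase m P (t + 1) = (staircase m P t).connectSucc (evenGen m ⟨t, h⟩) := by
  rw [staircase, dif_pos h]

variable {m}

/-- after a move at `j, j+1` the sites `j` and `j+1` are partners. [cite: PearceRittenbergDeGierNienhuis2002, §2 (monoid)] -/
theorem LinkPattern.connectSucc_partner_castSucc {n : ℕ} (P : LinkPattern (n + 1 + 1)) (j : Fin (n + 1)) :
    (P.connectSucc j).1.partner (Fin.castSucc j) = j.succ := by
  rw [LinkPattern.connectSucc_val]
  exact PerfectMatching.connect_partner_left P.1 (show Fin.castSucc j < j.succ from Fin.castSucc_lt_succ).ne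

/-- a move at `j, j+1` does not touch a pair `{x, y}` avoiding `j` and `j+1`. [cite: PearceRittenbergDeGierNienhuis2002, §2 (monoid)] -/
theorem LinkPattern.connectSucc_partner_of_ne {n : ℕ} (P : LinkPattern (n + 1 + 1)) (j : Fin (n + 1)) {x : Fin (n + 1 + 1)}
    (hx1 : x ≠ Fin.castSucc j) (hx2 : x ≠ j.succ) (hy1 : P.1.partner x ≠ Fin.castSucc j) (hy2 : P.1.partner x ≠ j.succ) :
    (P.connectSucc j).1.partner x = P.1.partner x := by
  rw [LinkPattern.connectSucc_val, PerfectMatching.connect_partner]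
  -- `x ∉ {j, P (j+1)}` and `P x ∉ {j, P (j+1)}`
  have hxb : x ≠ P.1.partner j.succ := fun e => hy2 (by rw [e, P.1.partner_partner])
  have hyb : P.1.partner x ≠ P.1.partner j.succ := fun e => hx2 (P.1.partner_inj.1 e)
  rw [Equiv.swap_apply_of_ne_of_ne hx1 hxb, Equiv.swap_apply_of_ne_of_ne hy1 hyb]

/-- ★ **after `t` steps of the staircase the sites `2i, 2i+1` are partners for every `i < t`.** [cite: RidoutSaintAubin2014TL, §3 proof of Prop. 3.3 (arXiv p. 13)] -/
theorem staircase_partner (P : LinkPattern (2 * m + 1 + 1)) :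
    ∀ t : ℕ, t ≤ m + 1 → ∀ i : Fin (2 * m + 1 + 1), i.val % 2 = 0 → i.val < 2 * t → ((staircase m P t).1.partner i).val = i.val + 1 := by
  intro t
  induction t with
  | zero => intro _ i _ hi; omega
  | succ t ih =>
    intro ht i hi hit
    have htm : t < m + 1 := by omega
    rw [staircase_succ m P htm]
    by_cases hnew : i.val = 2 * t
    · -- the new pair
      have ei : i = Fin.castSucc (evenGen m ⟨t, htm⟩) := Fin.ext (by rw [Fin.val_castSucc]; exact hnew)
      rw [ei, LinkPattern.connectSucc_partner_castSucc, Fin.val_succ, Fin.val_castSucc]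
    · -- an old pair, untouched
      have hlt : i.val < 2 * t := by omega
      have hold := ih (le_of_lt htm) i hi hlt
      have e1 : i ≠ Fin.castSucc (evenGen m ⟨t, htm⟩) := fun e => hnew (by rw [e, Fin.val_castSucc]; rfl)
      have e2 : i ≠ (evenGen m ⟨t, htm⟩).succ := fun e => by
        have := congrArg Fin.val e; rw [Fin.val_succ] at this; change i.val = 2 * t + 1 at this; omega
      have e3 : (staircase m P t).1.partner i ≠ Fin.castSucc (evenGen m ⟨t, htm⟩) := fun e => by
        have := congrArg Fin.val e; rw [hold, Fin.val_castSucc] at this; change i.val + 1 = 2 * t at this; omega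
      have e4 : (staircase m P t).1.partner i ≠ (evenGen m ⟨t, htm⟩).succ := fun e => by
        have := congrArg Fin.val e; rw [hold, Fin.val_succ] at this; change i.val + 1 = 2 * t + 1 at this; omega
      rw [LinkPattern.connectSucc_partner_of_ne _ _ e1 e2 e3 e4, hold]

/-- ★★ **THE ODD-STAIRCASE WORD COLLAPSES EVERY LINK PATTERN ONTO THE BASE PATTERN**: after the moves at `0, 2, …, 2m`, any `P` has become `base m`.
[cite: RidoutSaintAubin2014TL, §3 Prop. 3.3, proof (arXiv p. 13: `|x y| z = ⟨y, z⟩ x`); PearceRittenbergDeGierNienhuis2002, §2 (monoid)] -/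
theorem staircase_full (P : LinkPattern (2 * m + 1 + 1)) : staircase m P (m + 1) = LinkPattern.base m :=
  LinkPattern.eq_base_of_even m _ fun i hi => staircase_partner P (m + 1) le_rfl i hi (by have := i.2; omega)

end Staircase

/-! ### The collapsing endomorphism and the head lemma -/

section Collapse

variable (R : Type*) [CommRing R] (m : ℕ)

/-- **the collapsing endomorphism**: the composite `e_{2(t−1)} ∘ ⋯ ∘ e_2 ∘ e_0` at `δ = 1` (for `t` steps). [cite: RidoutSaintAubin2014TL, §3 proof of Prop. 3.3 (arXiv p. 13)] -/
noncomputable def collapseTo : ℕ → Module.End R (LinkPattern (2 * m + 1 + 1) →₀ R)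
  | 0 => LinearMap.id
  | t + 1 => if h : t < m + 1 then tlL R 1 (evenGen m ⟨t, h⟩) ∘ₗ collapseTo t else collapseTo t

/-- the full word `e_{2m} ∘ ⋯ ∘ e_0`. [cite: RidoutSaintAubin2014TL, §3 proof of Prop. 3.3 (arXiv p. 13)] -/
noncomputable def collapse : Module.End R (LinkPattern (2 * m + 1 + 1) →₀ R) := collapseTo R m (m + 1)

variable {R m}

/-- the partial word on a basis vector follows the staircase. [cite: RidoutSaintAubin2014TL, §3 (arXiv p. 13)] -/
theorem collapseTo_single (P : LinkPattern (2 * m + 1 + 1)) (c : R) : ∀ t : ℕ, collapseTo R m t (Finsupp.single P c) = Finsupp.single (staircase m P t) c := by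
  intro t
  induction t with
  | zero => rfl
  | succ t ih =>
    show (collapseTo R m (t + 1)) (Finsupp.single P c) = Finsupp.single (staircase m P (t + 1)) c
    rw [collapseTo, staircase]
    split_ifs with h
    · rw [LinearMap.comp_apply, ih, tlL_one_single]
    · exact ih

/-- ★★ **the collapsing word on a basis vector: `collapse (δ_P) = δ_base`.** [cite: RidoutSaintAubin2014TL, §3 Prop. 3.3, proof (arXiv p. 13)] -/
theorem collapse_single (P : LinkPattern (2 * m + 1 + 1)) (c : R) : collapse R m (Finsupp.single P c) = Finsupp.single (LinkPattern.base m) c := by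
  rw [collapse, collapseTo_single, staircase_full]

/-- ★★ **the collapsing word on any vector: `collapse x = ε(x) · δ_base`** (the «magic» identity `|base base| x = ⟨base, x⟩ base` at loop weight `1`).
[cite: RidoutSaintAubin2014TL, §3 Prop. 3.3, proof (arXiv p. 13: `|x y| z = ⟨y, z⟩ x`)] -/
theorem collapse_apply (x : LinkPattern (2 * m + 1 + 1) →₀ R) : collapse R m x = totalMass R x • Finsupp.single (LinkPattern.base m) 1 := by
  induction x using Finsupp.induction_linear with
  | zero => rw [map_zero, map_zero, zero_smul]
  | add x y hx hy => rw [map_add, map_add, hx, hy, add_smul]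
  | single P c => rw [collapse_single, totalMass_single, Finsupp.smul_single_one]

/-- the partial words preserve every subspace stable under the generators at `δ = 1`. [cite: RidoutSaintAubin2014TL, §3 (arXiv p. 13)] -/
theorem collapseTo_mem {W : Submodule R (LinkPattern (2 * m + 1 + 1) →₀ R)} (hW : ∀ (j : Fin (2 * m + 1)) (w : LinkPattern (2 * m + 1 + 1) →₀ R), w ∈ W → tlL R 1 j w ∈ W)
    {x : LinkPattern (2 * m + 1 + 1) →₀ R} (hx : x ∈ W) : ∀ t : ℕ, collapseTo R m t x ∈ W := by
  intro t
  induction t with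
  | zero => exact hx
  | succ t ih =>
    show (collapseTo R m (t + 1)) x ∈ W
    rw [collapseTo]
    split_ifs with h
    · rw [LinearMap.comp_apply]; exact hW _ _ ih
    · exact ih

end Collapse

section Head

variable {K : Type*} [Field K] {m : ℕ}

/-- ★★★ **THE HEAD LEMMA AT THE PERCOLATION POINT**: a subspace of the planar Temperley–Lieb module of `2m+2` sites which is stable under every generator `e_j` at
loop weight `1` and contains a vector of NON-ZERO TOTAL MASS contains the base link pattern (hence, by the transitivity of the Jones monoid — part 2 —, every link
pattern: it is the whole module; Ridout–Saint-Aubin: the radical `ker ε` is the unique maximal proper submodule).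
[cite: RidoutSaintAubin2014TL, §3 Prop. 3.3 and proof (arXiv p. 13); PearceRittenbergDeGierNienhuis2002, §2] -/
theorem single_base_mem_of_stable {W : Submodule K (LinkPattern (2 * m + 1 + 1) →₀ K)}
    (hW : ∀ (j : Fin (2 * m + 1)) (w : LinkPattern (2 * m + 1 + 1) →₀ K), w ∈ W → tlL K 1 j w ∈ W)
    {x : LinkPattern (2 * m + 1 + 1) →₀ K} (hx : x ∈ W) (hmass : totalMass K x ≠ 0) : Finsupp.single (LinkPattern.base m) 1 ∈ W := by
  have hc : collapse K m x ∈ W := collapseTo_mem hW hx (m + 1)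
  rw [collapse_apply] at hc
  have := W.smul_mem (totalMass K x)⁻¹ hc
  rwa [smul_smul, inv_mul_cancel₀ hmass, one_smul] at this

/-- equivalently: **a stable proper… — contrapositive form: a stable subspace NOT containing the base pattern lies in the hyperplane `ker ε`.**
[cite: RidoutSaintAubin2014TL, §3 Prop. 3.3 (arXiv p. 13: the radical is the unique maximal proper submodule)] -/
theorem le_ker_totalMass_of_stable {W : Submodule K (LinkPattern (2 * m + 1 + 1) →₀ K)}
    (hW : ∀ (j : Fin (2 * m + 1)) (w : LinkPattern (2 * m + 1 + 1) →₀ K), w ∈ W → tlL K 1 j w ∈ W)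
    (hbase : Finsupp.single (LinkPattern.base m) 1 ∉ W) : W ≤ LinearMap.ker (totalMass K) := by
  intro x hx
  rw [LinearMap.mem_ker]
  by_contra hne
  exact hbase (single_base_mem_of_stable hW hx hne)

end Head

/-! ## Part 2 — transitivity of the Jones monoid and the head of the planar module -/

namespace PerfectMatching

variable {L : ℕ} (p : PerfectMatching L)

/-- **the width of the chord at `i`**: `|p(i) − i|`. [cite: PearceRittenbergDeGierNienhuis2002, §2 (link diagrams)] -/
def width (i : Fin L) : ℕ := ((p.partner i).val - i.val) + (i.val - (p.partner i).val)

/-- **the area of a pairing**: the total chord width `Σ_i |p(i) − i|`. [cite: PearceRittenbergDeGierNienhuis2002, §2 (link diagrams)] -/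
def area : ℕ := ∑ i : Fin L, p.width i

end PerfectMatching

/-! ### Words of moves -/

namespace LinkPattern

variable {m : ℕ}

/-- **a word of nearest-neighbour moves applied to a link pattern** (left to right). [cite: PearceRittenbergDeGierNienhuis2002, §2 (monoid)] -/
noncomputable def applyMoves (P : LinkPattern (2 * m + 1 + 1)) (js : List (Fin (2 * m + 1))) : LinkPattern (2 * m + 1 + 1) :=
  js.foldl (fun Q j => Q.connectSucc j) P

/-- the empty word. [cite: PearceRittenbergDeGierNienhuis2002, §2 (monoid)] -/
theorem applyMoves_nil (P : LinkPattern (2 * m + 1 + 1)) : P.applyMoves [] = P := rfl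

/-- appending one move. [cite: PearceRittenbergDeGierNienhuis2002, §2 (monoid)] -/
theorem applyMoves_append_singleton (P : LinkPattern (2 * m + 1 + 1)) (js : List (Fin (2 * m + 1))) (j : Fin (2 * m + 1)) :
    P.applyMoves (js ++ [j]) = (P.applyMoves js).connectSucc j := by
  unfold applyMoves
  rw [List.foldl_append, List.foldl_cons, List.foldl_nil]

/-! ### A pattern with only nearest-neighbour chords is the base pattern -/

/-- ★ **a link pattern all of whose chords join neighbours is the base pattern.** [cite: PearceRittenbergDeGierNienhuis2002, §2 (link patterns)] -/
theorem eq_base_of_forall_adjacent (Q : LinkPattern (2 * m + 1 + 1)) (h : ∀ a : Fin (2 * m + 1 + 1), a < Q.1.partner a → (Q.1.partner a).val = a.val + 1) :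
    Q = base m := by
  apply eq_base_of_even
  -- by strong induction on the (even) site
  have key : ∀ n : ℕ, ∀ i : Fin (2 * m + 1 + 1), i.val = n → i.val % 2 = 0 → (Q.1.partner i).val = i.val + 1 := by
    intro n
    induction n using Nat.strong_induction_on with
    | _ n ih =>
      intro i hin hi
      by_cases hlt : i < Q.1.partner i
      · exact h i hlt
      · exfalso
        -- the partner `y` of `i` is below `i`, so `{y, i}` is a nearest-neighbour chord seen from `y`: `i = y + 1`, `y` odd
        set y := Q.1.partner i with hy
        have hyi : y < i := lt_of_le_of_ne (not_lt.1 hlt) (Q.1.partner_ne i)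
        have hQy : Q.1.partner y = i := by rw [hy, Q.1.partner_partner]
        have hy1 : i.val = y.val + 1 := by have := h y (by rw [hQy]; exact hyi); rw [hQy] at this; exact this
        -- `y − 1` is even and pairs with `y` by induction: contradiction
        have hy2 : 1 ≤ y.val := by rw [Fin.lt_def] at hyi; omega
        let y' : Fin (2 * m + 1 + 1) := ⟨y.val - 1, by have := y.2; omega⟩
        have hy' : (Q.1.partner y').val = y'.val + 1 := ih (y.val - 1) (by omega) y' rfl (by show (y.val - 1) % 2 = 0; omega)
        have hQy' : Q.1.partner y' = y := Fin.ext (by rw [hy']; show y.val - 1 + 1 = y.val; omega)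
        have : Q.1.partner y = y' := by rw [← hQy', Q.1.partner_partner]
        rw [hQy] at this
        have e := congrArg Fin.val this
        change i.val = y.val - 1 at e
        omega
  exact fun i hi => key i.val i rfl hi

/-- hence ★ **a link pattern other than the base pattern has a chord of width at least two.** [cite: PearceRittenbergDeGierNienhuis2002, §2 (link patterns)] -/
theorem exists_wide_chord {Q : LinkPattern (2 * m + 1 + 1)} (hQ : Q ≠ base m) :
    ∃ a : Fin (2 * m + 1 + 1), a < Q.1.partner a ∧ (Q.1.partner a).val ≠ a.val + 1 := by
  by_contra hne
  exact hQ (eq_base_of_forall_adjacent Q fun a ha => by by_contra h; exact hne ⟨a, ha, h⟩)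

/-- ★ **a non-adjacent chord `{a, c}` of minimal width encloses the nearest-neighbour chord `{a+1, a+2}`** (planarity keeps the partner of `a+1` inside `{a, c}`, minimality
makes that chord a nearest-neighbour one). [cite: PearceRittenbergDeGierNienhuis2002, §2 (non-intersecting half-loops)] -/
theorem exists_minimal_chord {Q : LinkPattern (2 * m + 1 + 1)} (hQ : Q ≠ base m) :
    ∃ a b d c : Fin (2 * m + 1 + 1), b.val = a.val + 1 ∧ d.val = a.val + 2 ∧ a.val + 3 ≤ c.val ∧
      Q.1.partner a = c ∧ Q.1.partner b = d := by
  classical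
  obtain ⟨a₀, ha₀, ha₀'⟩ := exists_wide_chord hQ
  set S : Finset (Fin (2 * m + 1 + 1)) := Finset.univ.filter fun a => a < Q.1.partner a ∧ (Q.1.partner a).val ≠ a.val + 1 with hS
  have hSne : S.Nonempty := ⟨a₀, Finset.mem_filter.2 ⟨Finset.mem_univ _, ha₀, ha₀'⟩⟩
  obtain ⟨a, haS, hmin⟩ := Finset.exists_min_image S (fun a => (Q.1.partner a).val - a.val) hSne
  obtain ⟨-, ha, ha'⟩ := Finset.mem_filter.1 haS
  set c := Q.1.partner a with hc
  rw [Fin.lt_def] at ha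
  have hc2 : a.val + 2 ≤ c.val := by omega
  let b : Fin (2 * m + 1 + 1) := ⟨a.val + 1, by have := c.2; omega⟩
  have hab : a < b := by show a.val < a.val + 1; omega
  have hbc : b < c := by show a.val + 1 < c.val; omega
  -- planarity: the partner of `b` lies inside `{a, c}`
  have hac' : a < Q.1.partner a := by rw [← hc]; exact Fin.lt_def.2 ha
  have hbc' : b < Q.1.partner a := by rw [← hc]; exact hbc
  obtain ⟨hb1, hb2⟩ := Q.2 a b hac' hab hbc'
  have hb1' : a.val < (Q.1.partner b).val := hb1
  have hb2' : (Q.1.partner b).val < c.val := hb2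
  clear hb1 hb2
  have hbne : Q.1.partner b ≠ b := Q.1.partner_ne b
  have hbval : (Q.1.partner b).val ≠ b.val := fun e => hbne (Fin.ext e)
  change (Q.1.partner b).val ≠ a.val + 1 at hbval
  -- so `b < Q b`; by minimality `{b, Q b}` is a nearest-neighbour chord
  have hbv : b.val = a.val + 1 := rfl
  have hblt : b < Q.1.partner b := by rw [Fin.lt_def]; omega
  have hQb : (Q.1.partner b).val = a.val + 2 := by
    by_contra hne2
    have hbS : b ∈ S := Finset.mem_filter.2 ⟨Finset.mem_univ _, hblt, fun e => hne2 (by omega)⟩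
    have := hmin b hbS
    change c.val - a.val ≤ (Q.1.partner b).val - (a.val + 1) at this
    omega
  let d : Fin (2 * m + 1 + 1) := ⟨a.val + 2, by omega⟩
  have hQbd : Q.1.partner b = d := Fin.ext hQb
  -- `c ≠ d` since `Q a = c`, `Q b = d`, `a ≠ b`
  have hcd : c ≠ d := by
    intro e
    have : Q.1.partner a = Q.1.partner b := by rw [← hc, e, hQbd]
    exact (ne_of_lt hab) (Q.1.partner_inj.1 this)
  have hcd' : c.val ≠ a.val + 2 := fun e => hcd (Fin.ext e)
  exact ⟨a, b, d, c, rfl, rfl, by omega, hc.symm, hQbd⟩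

/-! ### The lowering / raising identity -/

/-- ★★ **THE RAISING IDENTITY**: if `Q` has the chords `{a, c}` (`c ≥ a+3`) and `{a+1, a+2}`, then the move at `a, a+1` followed by the move at `a+1, a+2` gives `Q`
back: `(Q · e_a) · e_{a+1} = Q` (`Q · e_a` has the chords `{a, a+1}`, `{a+2, c}`). [cite: PearceRittenbergDeGierNienhuis2002, §2 (monoid); RidoutSaintAubin2014TL, §3 (arXiv p. 13)] -/
theorem connectSucc_connectSucc_eq (Q : LinkPattern (2 * m + 1 + 1)) {a b d c : Fin (2 * m + 1 + 1)} (hb : b.val = a.val + 1) (hd : d.val = a.val + 2)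
    (hc3 : a.val + 3 ≤ c.val) (hQa : Q.1.partner a = c) (hQb : Q.1.partner b = d) (j₁ j₂ : Fin (2 * m + 1)) (hj₁ : j₁.val = a.val)
    (hj₂ : j₂.val = a.val + 1) : (Q.connectSucc j₁).connectSucc j₂ = Q := by
  -- the sites of the two moves
  have e1 : Fin.castSucc j₁ = a := Fin.ext (by rw [Fin.val_castSucc, hj₁])
  have e2 : j₁.succ = b := Fin.ext (by rw [Fin.val_succ, hj₁, hb])
  have e3 : Fin.castSucc j₂ = b := Fin.ext (by rw [Fin.val_castSucc, hj₂, hb])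
  have e4 : j₂.succ = d := Fin.ext (by rw [Fin.val_succ, hj₂, hd])
  have hQc : Q.1.partner c = a := by rw [← hQa, Q.1.partner_partner]
  have hQd : Q.1.partner d = b := by rw [← hQb, Q.1.partner_partner]
  -- distinctness
  have hab : a ≠ b := fun e => by have := congrArg Fin.val e; omega
  have had : a ≠ d := fun e => by have := congrArg Fin.val e; omega
  have hac : a ≠ c := fun e => by have := congrArg Fin.val e; omega
  have hbd : b ≠ d := fun e => by have := congrArg Fin.val e; omega
  have hbc : b ≠ c := fun e => by have := congrArg Fin.val e; omega
  have hdc : d ≠ c := fun e => by have := congrArg Fin.val e; omega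
  -- the first move: chords `{a, b}`, `{c, d}`
  set Q₁ := Q.connectSucc j₁ with hQ₁
  have hQ₁v : Q₁.1 = Q.1.connect a b := by rw [hQ₁, connectSucc_val, e1, e2]
  have h1a : Q₁.1.partner a = b := by rw [hQ₁v]; exact PerfectMatching.connect_partner_left _ hab
  have h1b : Q₁.1.partner b = a := by rw [hQ₁v]; exact PerfectMatching.connect_partner_right _ hab
  have h1c : Q₁.1.partner c = d := by rw [hQ₁v, ← hQa, PerfectMatching.connect_partner_partner_left _ hab, hQb]
  have h1d : Q₁.1.partner d = c := by rw [hQ₁v, ← hQb, PerfectMatching.connect_partner_partner_right _ hab, hQa]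
  have h1x : ∀ x, x ≠ a → x ≠ b → x ≠ c → x ≠ d → Q₁.1.partner x = Q.1.partner x := by
    intro x hxa hxb hxc hxd
    rw [hQ₁v]
    exact PerfectMatching.connect_partner_of_ne _ hxa hxb (by rw [hQa]; exact hxc) (by rw [hQb]; exact hxd)
  -- the second move: back to `Q`
  apply Subtype.ext
  rw [connectSucc_val, e3, e4]
  apply PerfectMatching.ext
  funext x
  by_cases hxb : x = b
  · subst hxb; rw [PerfectMatching.connect_partner_left _ hbd, hQb]
  by_cases hxd : x = d
  · subst hxd; rw [PerfectMatching.connect_partner_right _ hbd, hQd]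
  by_cases hxa : x = a
  · subst hxa; rw [← h1b, PerfectMatching.connect_partner_partner_left _ hbd, h1b, h1d, hQa]
  by_cases hxc : x = c
  · subst hxc; rw [← h1d, PerfectMatching.connect_partner_partner_right _ hbd, h1d, h1b, hQc]
  rw [PerfectMatching.connect_partner_of_ne _ hxb hxd (by rw [h1b]; exact hxa) (by rw [h1d]; exact hxc), h1x x hxa hxb hxc hxd]

/-- ★ **the move at `a, a+1` lowers the area by `4`** (chords `{a, c}`, `{a+1, a+2}` ↦ `{a, a+1}`, `{a+2, c}`).
[cite: PearceRittenbergDeGierNienhuis2002, §2 (link diagrams)] -/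
theorem area_connectSucc_add_four (Q : LinkPattern (2 * m + 1 + 1)) {a b d c : Fin (2 * m + 1 + 1)} (hb : b.val = a.val + 1) (hd : d.val = a.val + 2)
    (hc3 : a.val + 3 ≤ c.val) (hQa : Q.1.partner a = c) (hQb : Q.1.partner b = d) (j₁ : Fin (2 * m + 1)) (hj₁ : j₁.val = a.val) :
    (Q.connectSucc j₁).1.area + 4 = Q.1.area := by
  classical
  have e1 : Fin.castSucc j₁ = a := Fin.ext (by rw [Fin.val_castSucc, hj₁])
  have e2 : j₁.succ = b := Fin.ext (by rw [Fin.val_succ, hj₁, hb])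
  have hQc : Q.1.partner c = a := by rw [← hQa, Q.1.partner_partner]
  have hQd : Q.1.partner d = b := by rw [← hQb, Q.1.partner_partner]
  have hab : a ≠ b := fun e => by have := congrArg Fin.val e; omega
  have had : a ≠ d := fun e => by have := congrArg Fin.val e; omega
  have hac : a ≠ c := fun e => by have := congrArg Fin.val e; omega
  have hbd : b ≠ d := fun e => by have := congrArg Fin.val e; omega
  have hbc : b ≠ c := fun e => by have := congrArg Fin.val e; omega
  have hdc : d ≠ c := fun e => by have := congrArg Fin.val e; omega
  set Q₁ := Q.connectSucc j₁ with hQ₁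
  have hQ₁v : Q₁.1 = Q.1.connect a b := by rw [hQ₁, connectSucc_val, e1, e2]
  have h1a : Q₁.1.partner a = b := by rw [hQ₁v]; exact PerfectMatching.connect_partner_left _ hab
  have h1b : Q₁.1.partner b = a := by rw [hQ₁v]; exact PerfectMatching.connect_partner_right _ hab
  have h1c : Q₁.1.partner c = d := by rw [hQ₁v, ← hQa, PerfectMatching.connect_partner_partner_left _ hab, hQb]
  have h1d : Q₁.1.partner d = c := by rw [hQ₁v, ← hQb, PerfectMatching.connect_partner_partner_right _ hab, hQa]
  have h1x : ∀ x, x ≠ a → x ≠ b → x ≠ c → x ≠ d → Q₁.1.partner x = Q.1.partner x := by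
    intro x hxa hxb hxc hxd
    rw [hQ₁v]
    exact PerfectMatching.connect_partner_of_ne _ hxa hxb (by rw [hQa]; exact hxc) (by rw [hQb]; exact hxd)
  -- split the sums over `S = {a, b, c, d}` and its complement
  set S : Finset (Fin (2 * m + 1 + 1)) := {a, b, c, d} with hS
  have hsplit : ∀ p : PerfectMatching (2 * m + 1 + 1), p.area = ∑ i ∈ S, p.width i + ∑ i ∈ Sᶜ, p.width i := fun p =>
    (Finset.sum_add_sum_compl S _).symm
  have hcompl : ∑ i ∈ Sᶜ, Q₁.1.width i = ∑ i ∈ Sᶜ, Q.1.width i := by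
    refine Finset.sum_congr rfl fun x hx => ?_
    rw [Finset.mem_compl, hS] at hx
    simp only [Finset.mem_insert, Finset.mem_singleton, not_or] at hx
    obtain ⟨hxa, hxb, hxc, hxd⟩ := hx
    unfold PerfectMatching.width
    rw [h1x x hxa hxb hxc hxd]
  have hSsum : ∀ p : PerfectMatching (2 * m + 1 + 1), ∑ i ∈ S, p.width i = p.width a + p.width b + p.width c + p.width d := by
    intro p
    rw [hS, Finset.sum_insert (by simp [hab, hac, had]), Finset.sum_insert (by simp [hbc, hbd]), Finset.sum_insert (by simp [hdc.symm]),
      Finset.sum_singleton]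
    ring
  unfold PerfectMatching.area at hsplit ⊢
  change ∑ i, Q₁.1.width i + 4 = ∑ i, Q.1.width i
  rw [hsplit Q₁.1, hsplit Q.1, hcompl, hSsum, hSsum]
  unfold PerfectMatching.width
  rw [h1a, h1b, h1c, h1d, hQa, hQb, hQc, hQd]
  omega

/-- the lowered pattern has smaller area. [cite: PearceRittenbergDeGierNienhuis2002, §2 (link diagrams)] -/
theorem area_connectSucc_lt (Q : LinkPattern (2 * m + 1 + 1)) {a b d c : Fin (2 * m + 1 + 1)} (hb : b.val = a.val + 1) (hd : d.val = a.val + 2)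
    (hc3 : a.val + 3 ≤ c.val) (hQa : Q.1.partner a = c) (hQb : Q.1.partner b = d) (j₁ : Fin (2 * m + 1)) (hj₁ : j₁.val = a.val) :
    (Q.connectSucc j₁).1.area < Q.1.area := by
  have := area_connectSucc_add_four Q hb hd hc3 hQa hQb j₁ hj₁
  omega

/-! ### Transitivity -/

/-- ★★★ **THE JONES MONOID ACTS TRANSITIVELY ON LINK PATTERNS**: every link pattern of `2m+2` sites is reached from the base pattern by a word of nearest-neighbour
moves (strong induction on the area: a pattern `≠ base` is one move above a pattern of smaller area).
[cite: RidoutSaintAubin2014TL, §3 Prop. 3.3 (arXiv p. 13: cyclicity of the standard module); PearceRittenbergDeGierNienhuis2002, §2 (monoid)] -/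
theorem exists_moves_eq (Q : LinkPattern (2 * m + 1 + 1)) : ∃ js : List (Fin (2 * m + 1)), (base m).applyMoves js = Q := by
  have key : ∀ n : ℕ, ∀ Q : LinkPattern (2 * m + 1 + 1), Q.1.area = n → ∃ js : List (Fin (2 * m + 1)), (base m).applyMoves js = Q := by
    intro n
    induction n using Nat.strong_induction_on with
    | _ n ih =>
      intro Q hQn
      by_cases hQ : Q = base m
      · exact ⟨[], by rw [applyMoves_nil, hQ]⟩
      · obtain ⟨a, b, d, c, hb, hd, hc3, hQa, hQb⟩ := exists_minimal_chord hQ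
        have hc := c.2
        let j₁ : Fin (2 * m + 1) := ⟨a.val, by omega⟩
        let j₂ : Fin (2 * m + 1) := ⟨a.val + 1, by omega⟩
        have hlt : (Q.connectSucc j₁).1.area < n := by rw [← hQn]; exact area_connectSucc_lt Q hb hd hc3 hQa hQb j₁ rfl
        obtain ⟨js, hjs⟩ := ih _ hlt (Q.connectSucc j₁) rfl
        refine ⟨js ++ [j₂], ?_⟩
        rw [applyMoves_append_singleton, hjs]
        exact connectSucc_connectSucc_eq Q hb hd hc3 hQa hQb j₁ j₂ rfl rfl
  exact key _ Q rfl

end LinkPattern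

/-! ### The planar module at `δ = 1` is generated by any vector of non-zero total mass -/

section Cyclic

variable {R : Type*} [CommRing R] {m : ℕ}

/-- a stable subspace containing `δ_P` contains `δ_{P · w}` for every word `w`. [cite: PearceRittenbergDeGierNienhuis2002, §2 (monoid)] -/
theorem single_applyMoves_mem_of_stable {W : Submodule R (LinkPattern (2 * m + 1 + 1) →₀ R)}
    (hW : ∀ (j : Fin (2 * m + 1)) (w : LinkPattern (2 * m + 1 + 1) →₀ R), w ∈ W → tlL R 1 j w ∈ W) {P : LinkPattern (2 * m + 1 + 1)}
    (hP : Finsupp.single P (1 : R) ∈ W) (js : List (Fin (2 * m + 1))) : Finsupp.single (P.applyMoves js) (1 : R) ∈ W := by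
  induction js using List.reverseRecOn with
  | nil => rw [LinkPattern.applyMoves_nil]; exact hP
  | append_singleton js j ih =>
    rw [LinkPattern.applyMoves_append_singleton, ← tlL_one_single]
    exact hW j _ ih

/-- ★★ **a stable subspace containing the base pattern contains every link pattern.** [cite: RidoutSaintAubin2014TL, §3 Prop. 3.3 (arXiv p. 13)] -/
theorem single_mem_of_stable_of_base {W : Submodule R (LinkPattern (2 * m + 1 + 1) →₀ R)}
    (hW : ∀ (j : Fin (2 * m + 1)) (w : LinkPattern (2 * m + 1 + 1) →₀ R), w ∈ W → tlL R 1 j w ∈ W)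
    (hbase : Finsupp.single (LinkPattern.base m) (1 : R) ∈ W) (Q : LinkPattern (2 * m + 1 + 1)) : Finsupp.single Q (1 : R) ∈ W := by
  obtain ⟨js, hjs⟩ := Q.exists_moves_eq
  rw [← hjs]
  exact single_applyMoves_mem_of_stable hW hbase js

/-- a subspace containing every basis vector is everything. [cite: RidoutSaintAubin2014TL, §3 (arXiv p. 13)] -/
theorem eq_top_of_forall_single_mem {W : Submodule R (LinkPattern (2 * m + 1 + 1) →₀ R)} (h : ∀ Q, Finsupp.single Q (1 : R) ∈ W) : W = ⊤ := by
  rw [eq_top_iff]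
  intro x hx
  clear hx
  induction x using Finsupp.induction_linear with
  | zero => exact W.zero_mem
  | add x y hx hy => exact W.add_mem hx hy
  | single Q c =>
    rw [← Finsupp.smul_single_one]
    exact W.smul_mem c (h Q)

variable {K : Type*} [Field K]

/-- ★★★ **RIDOUT–SAINT-AUBIN AT THE PERCOLATION POINT**: a subspace of the planar Temperley–Lieb module of `2m+2` sites (over a field) that is stable under every generator
`e_j` at loop weight `1` and contains a vector of non-zero total mass is the whole module — the module is generated by any vector outside the radical `ker ε`.
[cite: RidoutSaintAubin2014TL, §3 Prop. 3.3 and proof (arXiv p. 13); PearceRittenbergDeGierNienhuis2002, §2] -/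
theorem eq_top_of_stable {W : Submodule K (LinkPattern (2 * m + 1 + 1) →₀ K)}
    (hW : ∀ (j : Fin (2 * m + 1)) (w : LinkPattern (2 * m + 1 + 1) →₀ K), w ∈ W → tlL K 1 j w ∈ W)
    {x : LinkPattern (2 * m + 1 + 1) →₀ K} (hx : x ∈ W) (hmass : totalMass K x ≠ 0) : W = ⊤ :=
  eq_top_of_forall_single_mem (single_mem_of_stable_of_base hW (single_base_mem_of_stable hW hx hmass))

/-- ★★ **THE RADICAL IS THE UNIQUE MAXIMAL STABLE SUBSPACE**: every proper subspace stable under all generators at loop weight `1` lies in the hyperplane `ker ε`.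
[cite: RidoutSaintAubin2014TL, §3 Prop. 3.3 (arXiv p. 13: «the radical is the unique maximal proper submodule»)] -/
theorem le_ker_totalMass_of_stable_of_ne_top {W : Submodule K (LinkPattern (2 * m + 1 + 1) →₀ K)}
    (hW : ∀ (j : Fin (2 * m + 1)) (w : LinkPattern (2 * m + 1 + 1) →₀ K), w ∈ W → tlL K 1 j w ∈ W) (hne : W ≠ ⊤) :
    W ≤ LinearMap.ker (totalMass K) := by
  intro x hx
  rw [LinearMap.mem_ker]
  by_contra hmass
  exact hne (eq_top_of_stable hW hx hmass)

/-- ★★ **the span of a family of vectors of the planar module, stable under the generators at loop weight `1` and containing one vector of non-zero total mass, is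
everything** (the form used by the percolation lineage: boundary laws have positive mass). [cite: RidoutSaintAubin2014TL, §3 Prop. 3.3 (arXiv p. 13)] -/
theorem span_eq_top_of_stable {ι : Type*} (f : ι → LinkPattern (2 * m + 1 + 1) →₀ K)
    (hstab : ∀ (j : Fin (2 * m + 1)) (i : ι), tlL K 1 j (f i) ∈ Submodule.span K (Set.range f)) {i₀ : ι} (hmass : totalMass K (f i₀) ≠ 0) :
    Submodule.span K (Set.range f) = ⊤ := by
  refine eq_top_of_stable (W := Submodule.span K (Set.range f)) ?_ (Submodule.subset_span ⟨i₀, rfl⟩) hmass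
  intro j w hw
  refine Submodule.span_induction ?_ ?_ ?_ ?_ hw
  · rintro _ ⟨i, rfl⟩; exact hstab j i
  · rw [map_zero]; exact Submodule.zero_mem _
  · intro x y _ _ hx hy; rw [map_add]; exact Submodule.add_mem _ hx hy
  · intro c x _ hx; rw [map_smul]; exact Submodule.smul_mem _ c hx

end Cyclic

end Literature.Probability.LatticeModels.TemperleyLieb
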